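import Summits.QuantumFields.YangMills.Theorems.BalabanUVNodesN16SlotKeyOfThm1PrintClass

/-!
# Route «BalabanUVNodes», crux K3ᴬ `SpineGivenEndpointR13SepCoPHVAx` (stmt-QuantumFields-27247), node N16 = NE3, seam row S-N16-1′ (director-ym №575) — THE D-s3-3 FACES IN THE
# KERNEL: box CONTAINMENT and gauge RESTRICTION on leaf-06's torus carrier, print's cube WINDOW `R₁M₁ ≤ M ≤ N∕2 − 2R₁M₁` as a carrier (`torusVPWin`), and what
# [Balaban1985Variational] Theorem 1 ON THAT WINDOW gives AT NODE N16's COLLAR-SLOT CUBE: the slot key (T9ˢ) with the BOUND letter scaled by the size ratio and the CLASS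
# letter unchanged («decoupled»), (T8) verbatim — and why the COUPLED letter does not follow by restriction (the sub-clause merges into seam A1's letter coupling (r1))

Cell `pub-ymgap`, seat `pub-ymgap-dag-n16-e` (R134 (a), s2; HUMAN RULING D-0062; chair R424 venue), generation 32, module 69 (1 `def` — a cube-WINDOW variant of leaf-06's
`torusVP`, like module 68's `torusVPCls` — + theorems; 0 `sorry`, standard axioms; Theses-free).  `--kind definition --supports
stmt-QuantumFields-27247 --as helper` (count-neutral; proves NO registered stub; director-ym №575 (δ) GO «type the D-s3-3 faces (containment (1 + 2R₁M₁) ∕ torus cap) as ONE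
helper file»).  `bears_on: R4∕N16 · seam S-N16-1′ sub-clause D-s3-3`.  Over module 68 (✓p823387∕✓p824462: `torusVPCls`, `reg910Slot_of_thm1At_torusVPCls`), leaf-06's
`MinimalActionDictionary` (`torusVP`, `cubeM`, `gaugeFactors`, `gaugeInf`, `RadiiMono`, `cubeM_pos`, `cubeM_slot_le`), dag-n16-w1 files 3∕9 (`lipGauge`, `two_le_cubeM_slot`),
pub-balaban `AveragingDeficitCounting.mem_box_iff`, r2's `B11.Regularity` ∕ `B11Thm1.Thm1At` — CITED BY NAME, none edited.

THE SUB-CLAUSE (lit-balaban lead g45, the (i) dictionary line of record, pub-ymgap INBOX l.12703, row D-s3-3): print's regularity cubes ([Balaban1985Variational] p. 278 last line –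
p. 279 L1–5: «□ has a size 2ML^jη, where M is a multiple of R₁M₁ … the cube □̃ of the size (2M + 4R₁M₁)L^jη … is contained in B^j(Λ_j) ∪ B^{j+1}(Λ_{j+1})»; Thm 1: «M ≤ M(ε₁)»,
«M(ε₁) = R₁M₁(a₁∕ε₁)») form a WINDOW `R₁M₁ ≤ M` (multiples) with the TORUS CAP `2M + 4R₁M₁ ≤ N` (□̃ inside one period); module 68's `torusVPCls` reads the window as `1 ≤ M`,
no cap; the desk accepted «YES up to constants» by the elementary CONTAINMENT «every centred box of size `M ≥ 1` lies inside a class box of size `M′ ≤ M + 2R₁M₁`, whose printed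
gauge RESTRICTS to it» — asserted, not typed — with the located rider (r1): the enlarged letter `B₃` is ALSO the (8)-class radius, so the enlargement rides on seam A1.
THIS FILE TYPES THE CONTAINMENT AND THE RESTRICTION, puts print's window into a carrier, and computes EXACTLY what Theorem 1 on the window yields at the collar-slot cube.

CONTENTS.  §1 boxes: pub-balaban's `AveragingDeficitCounting.box_mono` (`K ≤ K′ ⇒ box K y ⊆ box K′ y`, cited); box-ANTITONE gauge shapes (a gauge shape on a box restricts to every concentric sub-box — the hypothesis `hG` of §1–§2, written out) and `boxAnti_lipGauge`;
`gaugeFactors_subset_of_le`, `gaugeInf_le_of_le` (the least admissible common factor `Ψ` is MONOTONE in the box).  §2 ★ `regularity_torusVP_of_le_box`: r2's `Regularity` for the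
torus instance at `(y, K′)` with bound letter `B₃` ⟹ `Regularity` at every concentric `(y, K)`, `K ≤ K′`, with bound letter `B₃ · (M′∕M)` (`M = cubeM L k K`, `M′ = cubeM L k K′`) —
RESTRICTION COSTS THE SIZE RATIO, because (9)–(10) are `M`-proportional; `regularity_torusVP_mono_bound` (a larger bound letter is weaker).  §3 containment arithmetic:
`exists_concentric_window_box` — for `1 ≤ R` and any box `(y, K)`, a concentric `K′ ≥ K` with `R ≤ cubeM L k K′ ≤ max (cubeM L k K) (R + 3∕2)` (take `K′ := max K (⌈R⌉₊·L^k)`).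
§4 print's window as a carrier: `torusVPWin d L N G k Mlo Mhi` = `torusVP` with `Cube := {c ∕∕ Mlo ≤ cubeM L k c.2 ∧ cubeM L k c.2 ≤ Mhi}` (`Iff.rfl` face to `torusVP`'s
`Regularity`); print: `Mlo = R₁M₁`, `Mhi = N∕2 − 2R₁M₁`.  §5 ★★ `slotKeyDecoupled_of_thm1At_torusVPWin`: from `∀ k, Thm1At C (torusVPWin d L N (lipGauge d n) (k+1) R₁M₁ Mhi)` with
`1 ≤ R₁M₁`, `max (7∕2) (R₁M₁ + 3∕2) ≤ Mhi` and `M(e) ≥ max (7∕2) (R₁M₁ + 3∕2)`: for every run, every `0 < ε₁ ≤ a₁`, every `ε₁`-datum and every minimiser over the (8)-class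
`sfClass (C.B₃·ε₁)` (CLASS LETTER `C.B₃`, unchanged), r2's `Regularity` on the collar-slot cube about every site WITH BOUND LETTER `(R₁M₁ + 3∕2)·C.B₃` — the DECOUPLED slot key;
`exists8Min_of_thm1At_torusVPWin` ((T8) verbatim).  §6 (docstring, located, no kernel negative claimed): the COUPLED slot key (one letter `C′.B₃` for class AND bound, dag-n16-w1
file 9's (T9ˢ), which node N16's leaf `leafH3sup_loose_of_reg910Slot` consumes) does NOT follow from Theorem 1 on print's window by restriction + rescaling: matching the class
forces `ε₁ ↦ ρε₁` and the `M`-proportional bound then carries `ρ·M′ ≥ ρ·M_slot·ρ`, one factor `ρ = M′∕M_slot ≥ R₁M₁∕(7∕2)` too many; closing that factor needs the class-radius ∕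
bound-letter DECOUPLING, i.e. that the minimiser over `sfClass (ρB₃ε₁)` with an `ε₁`-datum is the one over `sfClass (B₃ε₁)` — print's uniqueness in (6) WITH the current
condition — exactly seam A1's located rider (r1).  So after this file the D-s3-3 sub-clause of S-N16-1′ reads: «containment + restriction TYPED (this file); residual = the letter
coupling (r1), part of A1» — the desk's∕★★★'s wording to set, not this file's.

HONEST FRAMING.  One dictionary-side `def` (a window variant of leaf-06's carrier) + elementary kernel facts (box inclusion, `sInf` monotonicity, real
arithmetic) + composition BY NAME; no estimate of Bałaban's proved.  `Thm1At C (torusVPWin …)` is a HYPOTHESIS ([Balaban1985Variational] Theorem 1 itself read at leaf-06's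
(42)-torus carrier on print's cube window; divergences D-s3-1 (A1) ∕ D-s3-2 ∕ D-s3-4∕5 as declared by leaf-06 and by the (i) line; the residual of D-s3-3 after this file =
«multiples of R₁M₁, block-aligned even cubes vs all centred odd boxes in the window» — leaf-06's base geometry, shared by every `torusVP` user).  Nothing booked; N16 TABLED
under №572 (tokens 2∕3 at filing); S-N16-1′'s wording is the director's (№575); COUNT 8∕27 (A 8∕28) · K3ᴬ 0∕2 UNMOVED.  One finite four-torus at fixed `ε`, Bałaban AS PRINTED
— NOT ℝ⁴, NOT infinite volume, NOT OS, NOT a mass gap; the YM mass gap (Clay) is NOT proved by any of this.  No `sorry` ∕ `instance` ∕ `notation`; standard axioms.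
References: [Balaban1985Variational] T. Bałaban, CMP **102** (1985) 277–309: (1) p. 277, (2)–(8) p. 278, p. 279 L1–5 (cube class), Thm 1 (8)–(10) p. 279, Sect. F p. 300.
-/

set_option autoImplicit false

open scoped BigOperators Matrix Matrix.Norms.L2Operator
open NormedSpace

namespace Summit.QuantumFields.YangMills.BalabanUVNodes.N16SlotKeyClassContainment

open Literature.MathematicalPhysics.QuantumFieldTheory.Balaban1983to89
open B7Prop1Explicit B7Prop2Explicit MatrixLog UnitaryModel
open T4AveragingDeficitWall hiding Site Plane Plaq Bond
open Summit.QuantumFields.BalabanUV.T4Continuum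
open AveragingDeficitCounting (mem_box_iff box_mono)
open MinimalActionSandwich (IsMinimiser)
open MinimalActionRate (sfClass)
open MinimalActionDictionary (torusVP RadiiMono cubeM gaugeFactors gaugeInf cubeM_pos cubeM_slot_le sfClass_mono)
open B11 (VarProblem Regularity)
open B11Thm1 (Thm1At Exists8 Unique6 Reg910)
open Summit.QuantumFields.YangMills.BalabanUVNodes.N16H7OfN07RecordSlot (lipGauge)
open Summit.QuantumFields.YangMills.BalabanUVNodes.N16H7LooseOfReg910Slot (two_le_cubeM_slot)

noncomputable section

variable {d : ℕ} {n : Type} [Fintype n] [DecidableEq n]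

/-! ## §1 Boxes, box-antitone gauge shapes, and the least admissible common factor -/

/-- dag-n16-w1's `lipGauge` is BOX-ANTITONE (a gauge shape on a box restricts to every concentric sub-box with the same radii): the same gauge `u` and potential `a`, with their bounds on the larger box, serve the smaller box. [folklore] -/
theorem boxAnti_lipGauge : ∀ (U : Site d → Fin d → (Matrix n n ℂ)ˣ) (y : Site d) (K K' : ℕ) (α₀ α₁ α₂ : ℝ),
    K ≤ K' → lipGauge d n U y K' α₀ α₁ α₂ → lipGauge d n U y K α₀ α₁ α₂ := by
  intro U y K K' α₀ α₁ α₂ hK h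
  obtain ⟨u, a, hu, hexp, h0, h1, h2⟩ := h
  have hs := box_mono hK y
  exact ⟨u, a, hu, fun z τ hz => hexp z τ (hs hz), fun z τ hz => h0 z τ (hs hz), fun z τ i hz => h1 z τ i (hs hz), fun z τ i l hz => h2 z τ i l (hs hz)⟩

variable {G : (Site d → Fin d → (Matrix n n ℂ)ˣ) → Site d → ℕ → ℝ → ℝ → ℝ → Prop} {L N k : ℕ}

/-- The admissible common factors on a larger box are admissible on every concentric sub-box. [folklore] -/
theorem gaugeFactors_subset_of_le (hG : ∀ (U : Site d → Fin d → (Matrix n n ℂ)ˣ) (y : Site d) (K K' : ℕ) (α₀ α₁ α₂ : ℝ), K ≤ K' → G U y K' α₀ α₁ α₂ → G U y K α₀ α₁ α₂) (U : Site d → Fin d → (Matrix n n ℂ)ˣ) (y : Site d) {K K' : ℕ} (hK : K ≤ K') :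
    gaugeFactors G L k U y K' ⊆ gaugeFactors G L k U y K := by
  intro t ht
  exact ⟨ht.1, hG U y K K' _ _ _ hK ht.2⟩

/-- **`Ψ` IS MONOTONE IN THE BOX**: the least admissible common factor of a sub-box is at most that of a concentric larger box carrying a gauge. [folklore] -/
theorem gaugeInf_le_of_le (hG : ∀ (U : Site d → Fin d → (Matrix n n ℂ)ˣ) (y : Site d) (K K' : ℕ) (α₀ α₁ α₂ : ℝ), K ≤ K' → G U y K' α₀ α₁ α₂ → G U y K α₀ α₁ α₂) (U : Site d → Fin d → (Matrix n n ℂ)ˣ) (y : Site d) {K K' : ℕ} (hK : K ≤ K')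
    (hne : (gaugeFactors G L k U y K').Nonempty) : gaugeInf G L k U y K ≤ gaugeInf G L k U y K' :=
  csInf_le_csInf ⟨0, fun _ ht => ht.1⟩ hne (gaugeFactors_subset_of_le hG U y hK)

/-- Elementary sign bookkeeping for the `M`-proportional Hölder clause: `0 < B·M′·e·X` with `M, M′ > 0` gives `0 < B·M·e·X`. [folklore] -/
theorem pos_of_pos_rescale {B M M' e X : ℝ} (hM : 0 < M) (hM' : 0 < M') (h : 0 < B * M' * e * X) : 0 < B * M * e * X := by
  have e1 : B * M' * e * X = M' * (B * e * X) := by ring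
  rw [e1] at h
  have h2 : 0 < B * e * X := (mul_pos_iff_of_pos_left hM').mp h
  have e2 : B * M * e * X = M * (B * e * X) := by ring
  rw [e2]
  exact mul_pos hM h2

/-! ## §2 ★ Restriction of r2's `Regularity` on leaf-06's torus carrier costs the size ratio -/

/-- **★ RESTRICTION FACE.**  For a box-antitone shape `G` (`hG`) and `L ≥ 1`: r2's `Regularity` ((9) ∧ (10) in some gauge) for `torusVP d L N G k` at the box `(y, K′)` with bound letter
`B₃` gives `Regularity` at every concentric box `(y, K)`, `K ≤ K′`, with bound letter `B₃ · (cubeM L k K′ ∕ cubeM L k K)`: the printed bounds are `M`-PROPORTIONAL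
(`< B₃·M·ε₁·ξ^{−j}`), the gauge restricts with its factor `< B₃·M′·ε₁` unchanged, and `B₃·M′ = (B₃·M′∕M)·M`.  This is the containment step of the (i) line's row D-s3-3, typed —
with the BOUND letter only (the (8)-class letter lives in `OnMinimalOrbit`, untouched here). [cite: Balaban1985Variational, Thm 1 (9)–(10) p.279] [folklore] -/
theorem regularity_torusVP_of_le_box (hG : ∀ (U : Site d → Fin d → (Matrix n n ℂ)ˣ) (y : Site d) (K K' : ℕ) (α₀ α₁ α₂ : ℝ), K ≤ K' → G U y K' α₀ α₁ α₂ → G U y K α₀ α₁ α₂) (hL : 1 ≤ L) {B₃ B₄ ε : ℝ} {U : Site d → Fin d → (Matrix n n ℂ)ˣ} {y : Site d} {K K' : ℕ} (hK : K ≤ K')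
    (hreg : Regularity (torusVP d L N G k) B₃ B₄ ε U (y, K')) :
    Regularity (torusVP d L N G k) (B₃ * (cubeM L k K' / cubeM L k K)) B₄ ε U (y, K) := by
  obtain ⟨hne, h9, h9', hH, h10⟩ := hreg
  have hM : 0 < cubeM L k K := cubeM_pos hL k K
  have hM' : 0 < cubeM L k K' := cubeM_pos hL k K'
  have hne' : (gaugeFactors G L k U y K').Nonempty := hne
  have hΨ : gaugeInf G L k U y K ≤ gaugeInf G L k U y K' := gaugeInf_le_of_le hG U y hK hne'
  have hB : ∀ X : ℝ, B₃ * (cubeM L k K' / cubeM L k K) * cubeM L k K * ε * X = B₃ * cubeM L k K' * ε * X := by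
    intro X
    rw [mul_assoc B₃, div_mul_cancel₀ _ hM.ne']
  refine ⟨hne'.mono (gaugeFactors_subset_of_le hG U y hK), ?_, ?_, ?_, ?_⟩
  · show gaugeInf G L k U y K < B₃ * (cubeM L k K' / cubeM L k K) * cubeM L k K * ε * _
    rw [hB]; exact lt_of_le_of_lt hΨ h9
  · show gaugeInf G L k U y K < B₃ * (cubeM L k K' / cubeM L k K) * cubeM L k K * ε * _
    rw [hB]; exact lt_of_le_of_lt hΨ h9'
  · intro β hβ0 hβ1
    have h' := hH β hβ0 hβ1
    dsimp only [torusVP] at h' ⊢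
    exact pos_of_pos_rescale hM hM' h'
  · show gaugeInf G L k U y K < B₃ * (cubeM L k K' / cubeM L k K) * cubeM L k K * ε * _
    rw [hB]; exact lt_of_le_of_lt hΨ h10

/-- A larger BOUND letter is weaker (`0 < ε`, `L ≥ 1`): `Regularity` at `(y, K)` with `B₃` implies it with any `B₃′ ≥ B₃`. [folklore] -/
theorem regularity_torusVP_mono_bound (hL : 1 ≤ L) {B₃ B₃' B₄ ε : ℝ} (hB : B₃ ≤ B₃') (hε : 0 < ε) {U : Site d → Fin d → (Matrix n n ℂ)ˣ} {y : Site d} {K : ℕ}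
    (hreg : Regularity (torusVP d L N G k) B₃ B₄ ε U (y, K)) : Regularity (torusVP d L N G k) B₃' B₄ ε U (y, K) := by
  obtain ⟨hne, h9, h9', hH, h10⟩ := hreg
  have hM : 0 < cubeM L k K := cubeM_pos hL k K
  have hL0 : (0 : ℝ) < (L : ℝ) ^ k := by
    have : (0 : ℝ) < L := by exact_mod_cast (by omega : 0 < L)
    positivity
  have hf : ((L : ℝ) ^ k * (((L : ℝ) ^ k)⁻¹))⁻¹ = 1 := by rw [mul_inv_cancel₀ hL0.ne', inv_one]
  have hmono : ∀ j : ℕ, B₃ * cubeM L k K * ε * (((L : ℝ) ^ k * (((L : ℝ) ^ k)⁻¹))⁻¹) ^ j ≤ B₃' * cubeM L k K * ε * (((L : ℝ) ^ k * (((L : ℝ) ^ k)⁻¹))⁻¹) ^ j := by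
    intro j
    rw [hf, one_pow, mul_one, mul_one]
    have : 0 < cubeM L k K * ε := mul_pos hM hε
    nlinarith
  refine ⟨hne, ?_, ?_, hH, ?_⟩
  · exact lt_of_lt_of_le h9 (hmono 1)
  · exact lt_of_lt_of_le h9' (hmono 2)
  · exact lt_of_lt_of_le h10 (hmono 3)

/-! ## §3 Containment arithmetic: a concentric window box about any box -/

/-- **CONTAINMENT.**  For `L ≥ 1`, `1 ≤ R` and any box `(y, K)` at level `k` there is a concentric box `(y, K′)`, `K ≤ K′`, whose size parameter lies in `[R, max M (R + 3∕2)]`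
(`M = cubeM L k K`): take `K′ := max K (⌈R⌉₊ · L^k)` (`cubeM L k (⌈R⌉₊L^k) = ⌈R⌉₊ + 1∕(2L^k) ∈ [R, R + 3∕2]`).  With `R := R₁M₁` this is the (i) line's «every centred box lies
inside a class box of size `≤ M + 2R₁M₁`» (here the sharper `max M (R₁M₁ + 3∕2)`). [folklore] -/
theorem exists_concentric_window_box (hL : 1 ≤ L) (k K : ℕ) {R : ℝ} (hR : 1 ≤ R) :
    ∃ K' : ℕ, K ≤ K' ∧ R ≤ cubeM L k K' ∧ cubeM L k K' ≤ max (cubeM L k K) (R + 3 / 2) := by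
  have hLk : (1 : ℝ) ≤ (L : ℝ) ^ k := by exact_mod_cast Nat.one_le_pow _ _ hL
  have hLk0 : (0 : ℝ) < (L : ℝ) ^ k := lt_of_lt_of_le one_pos hLk
  by_cases hKR : R ≤ cubeM L k K
  · exact ⟨K, le_rfl, hKR, le_max_left _ _⟩
  · refine ⟨max K (⌈R⌉₊ * L ^ k), le_max_left _ _, ?_, ?_⟩
    · -- `R ≤ cubeM` at `K′ ≥ ⌈R⌉₊ L^k`
      have hK' : (⌈R⌉₊ * L ^ k : ℕ) ≤ max K (⌈R⌉₊ * L ^ k) := le_max_right _ _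
      have hceil : R ≤ (⌈R⌉₊ : ℝ) := Nat.le_ceil R
      have h1 : (⌈R⌉₊ : ℝ) * (L : ℝ) ^ k ≤ ((max K (⌈R⌉₊ * L ^ k) : ℕ) : ℝ) := by exact_mod_cast hK'
      unfold cubeM
      rw [le_div_iff₀ (by positivity)]
      nlinarith
    · -- `cubeM K′ ≤ R + 3∕2` when `K′ = ⌈R⌉₊ L^k`, else `= cubeM K`
      rcases le_total K (⌈R⌉₊ * L ^ k) with hle | hle
      · rw [max_eq_right hle]
        refine le_trans ?_ (le_max_right _ _)
        have hceil : (⌈R⌉₊ : ℝ) < R + 1 := Nat.ceil_lt_add_one (le_trans zero_le_one hR)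
        unfold cubeM
        rw [div_le_iff₀ (by positivity)]
        push_cast
        nlinarith
      · rw [max_eq_left hle]
        exact le_max_left _ _

/-! ## §4 Print's cube WINDOW as a carrier -/

variable (d) in
/-- **THE TORUS INSTANCE OF r2's CARRIER WITH THE CUBE FAMILY CUT TO A SIZE WINDOW `Mlo ≤ M ≤ Mhi`** — leaf-06's `torusVP d L N G k` field for field (like module 68's `torusVPCls`),
`Cube := {c : Site d × ℕ ∕∕ Mlo ≤ cubeM L k c.2 ∧ cubeM L k c.2 ≤ Mhi}`.  Print's window ([Balaban1985Variational] p. 279 L1–5, Thm 1): `Mlo = R₁M₁` (cubes are multiples of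
`R₁M₁` big blocks), `Mhi = N∕2 − 2R₁M₁` (the torus cap: the collar cube □̃ of size `2M + 4R₁M₁` fits in one period of `N·L^k` sites).  A dictionary VARIANT; nothing asserted.
[cite: Balaban1985Variational, (2)–(8) p.278, Thm 1 (8)–(10) p.279] [folklore] -/
@[folklore]
def torusVPWin (L N : ℕ) (G : (Site d → Fin d → (Matrix n n ℂ)ˣ) → Site d → ℕ → ℝ → ℝ → ℝ → Prop) (k : ℕ) (Mlo Mhi : ℝ) : VarProblem where
  Cfg := Site d → Fin d → (Matrix n n ℂ)ˣ
  Bdry := Site d → Fin d → (Matrix n n ℂ)ˣ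
  Cube := {c : Site d × ℕ // Mlo ≤ cubeM L k c.2 ∧ cubeM L k c.2 ≤ Mhi}
  scale := fun _ => k
  sizeM := fun c => cubeM L k c.1.2
  eta := ((L : ℝ) ^ k)⁻¹
  L := L
  InU := fun e U => U ∈ sfClass d L N e k
  InB := fun V U => avgIter L U k = V
  Reg7 := fun e V => V ∈ sfClass d L N e 0
  OnMinimalOrbit := fun e V U => IsMinimiser d (sfClass d L N e) L N k V U
  UniqueCriticalOrbit := fun _ _ _ => True
  Gauged := fun U c => (gaugeFactors G L k U c.1.1 c.1.2).Nonempty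
  normA := fun U c => gaugeInf G L k U c.1.1 c.1.2
  normGradA := fun U c => gaugeInf G L k U c.1.1 c.1.2
  holderA := fun _ _ _ => 0
  normLapA := fun U c => gaugeInf G L k U c.1.1 c.1.2

/-- Face (`Iff.rfl`): r2's `Regularity` at a window cube IS `torusVP`'s at the underlying cube. [folklore] -/
theorem regularity_torusVPWin_iff {Mlo Mhi : ℝ} (B₃ B₄ ε : ℝ) (U : Site d → Fin d → (Matrix n n ℂ)ˣ)
    (c : {c : Site d × ℕ // Mlo ≤ cubeM L k c.2 ∧ cubeM L k c.2 ≤ Mhi}) :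
    Regularity (torusVPWin d L N G k Mlo Mhi) B₃ B₄ ε U c ↔ Regularity (torusVP d L N G k) B₃ B₄ ε U c.1 :=
  Iff.rfl

/-- The collar-slot cube `K = L^k − 1 + L^k + 2` has `2 ≤ M ≤ 7∕2`; it lies in the window `[Mlo, Mhi]` whenever `Mlo ≤ 2` and `7∕2 ≤ Mhi` — for print's `Mlo = R₁M₁` («M₁
sufficiently large») it is in general NOT a window cube, which is why §5 goes through a concentric window box. [folklore] -/
theorem slot_mem_window_iff_le (hL : 1 ≤ L) (k : ℕ) {Mlo Mhi : ℝ} (hlo : Mlo ≤ 2) (hhi : 7 / 2 ≤ Mhi) :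
    Mlo ≤ cubeM L k (L ^ k - 1 + L ^ k + 2) ∧ cubeM L k (L ^ k - 1 + L ^ k + 2) ≤ Mhi :=
  ⟨hlo.trans (two_le_cubeM_slot hL k), (cubeM_slot_le hL k).trans hhi⟩

/-! ## §5 ★★ What Theorem 1 on print's window gives at node N16's collar-slot cube: the DECOUPLED slot key -/

/-- **★★ THE DECOUPLED SLOT KEY FROM THEOREM 1 ON PRINT's CUBE WINDOW.**  Let `L ≥ 1`, `1 ≤ R₁M₁`, the window's top `Mhi ≥ max (7∕2) (R₁M₁ + 3∕2)` (print: `N∕2 − 2R₁M₁`, so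
`N ≥ 6R₁M₁ + 3` suffices), the ceiling `M(e) ≥ max (7∕2) (R₁M₁ + 3∕2)` on `0 < e ≤ a₁` (print: `M(ε₁) = R₁M₁a₁∕ε₁ ≥ R₁M₁`; a located side condition when `R₁M₁ + 3∕2 > M(ε₁)`),
and `∀ k, Thm1At C (torusVPWin d L N (lipGauge d n) (k+1) R₁M₁ Mhi)` — [Balaban1985Variational] Theorem 1 read at leaf-06's (42)-torus carrier ON PRINT's WINDOW.  THEN for every
run, every `0 < ε₁ ≤ a₁`, every datum `V ∈ sfClass d L N ε₁ 0`, every minimiser `U` over the (8)-class `sfClass d L N (C.B₃·ε₁) (k+1)` — CLASS LETTER `C.B₃` UNCHANGED — and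
every site `x`: r2's `Regularity` on the collar-slot cube `(x, L^{k+1} − 1 + L^{k+1} + 2)` WITH BOUND LETTER `(R₁M₁ + 3∕2)·C.B₃`.  Proof: §3 gives a concentric window box
`(x, K′)` of size `M′ ∈ [R₁M₁, max M_slot (R₁M₁ + 3∕2)]`; Thm 1's `Reg910` there; §2 restricts to the slot cube at the cost `M′∕M_slot ≤ M′∕2 ≤ …`, then `mono_bound`.
[cite: Balaban1985Variational, Thm 1 (9)–(10) p.279, p.279 L1–5] [folklore] -/
theorem slotKeyDecoupled_of_thm1At_torusVPWin (hL : 1 ≤ L) {R₁M₁ Mhi : ℝ} (hR : 1 ≤ R₁M₁) (hhi : max (7 / 2) (R₁M₁ + 3 / 2) ≤ Mhi)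
    (C : B11Thm1.Consts) (hM : ∀ e : ℝ, 0 < e → e ≤ C.a₁ → max (7 / 2) (R₁M₁ + 3 / 2) ≤ C.Mfun e)
    (hT : ∀ k : ℕ, Thm1At C (torusVPWin d L N (lipGauge d n) (k + 1) R₁M₁ Mhi)) :
    ∀ (k : ℕ) (ε₁ : ℝ), 0 < ε₁ → ε₁ ≤ C.a₁ → ∀ (V U : Site d → Fin d → (Matrix n n ℂ)ˣ), V ∈ sfClass d L N ε₁ 0 →
      IsMinimiser d (sfClass d L N (C.B₃ * ε₁)) L N (k + 1) V U →
        ∀ x : Site d, Regularity (torusVP d L N (lipGauge d n) (k + 1)) ((R₁M₁ + 3 / 2) * C.B₃) C.B₄ ε₁ U (x, L ^ (k + 1) - 1 + L ^ (k + 1) + 2) := by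
  intro k ε₁ hε₁ hε₁a V U hV hU x
  set Ks : ℕ := L ^ (k + 1) - 1 + L ^ (k + 1) + 2 with hKs
  obtain ⟨K', hKK', hRK', hK'le⟩ := exists_concentric_window_box (L := L) hL (k + 1) Ks hR
  have hMs2 : 2 ≤ cubeM L (k + 1) Ks := two_le_cubeM_slot hL (k + 1)
  have hMs72 : cubeM L (k + 1) Ks ≤ 7 / 2 := cubeM_slot_le hL (k + 1)
  have hK'max : cubeM L (k + 1) K' ≤ max (7 / 2) (R₁M₁ + 3 / 2) :=
    hK'le.trans (max_le_max hMs72 le_rfl)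
  have hK'hi : cubeM L (k + 1) K' ≤ Mhi := hK'max.trans hhi
  have hK'M : cubeM L (k + 1) K' ≤ C.Mfun ε₁ := hK'max.trans (hM ε₁ hε₁ hε₁a)
  -- Theorem 1's regularity clause at the window cube `(x, K′)`
  obtain ⟨-, -, h910⟩ := hT k ε₁ hε₁ hε₁a V hV
  have hreg' : Regularity (torusVP d L N (lipGauge d n) (k + 1)) C.B₃ C.B₄ ε₁ U (x, K') :=
    (regularity_torusVPWin_iff C.B₃ C.B₄ ε₁ U ⟨(x, K'), hRK', hK'hi⟩).1 (h910 U hU ⟨(x, K'), hRK', hK'hi⟩ hK'M)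
  -- restrict to the slot cube (cost: the size ratio), then enlarge the bound letter to `(R₁M₁ + 3∕2)·B₃`
  have hres := regularity_torusVP_of_le_box (N := N) (k := k + 1) boxAnti_lipGauge hL hKK' hreg'
  have hMs0 : 0 < cubeM L (k + 1) Ks := cubeM_pos hL (k + 1) Ks
  have hratio : cubeM L (k + 1) K' / cubeM L (k + 1) Ks ≤ R₁M₁ + 3 / 2 := by
    rw [div_le_iff₀ hMs0]
    rcases le_total (cubeM L (k + 1) Ks) (R₁M₁ + 3 / 2) with h | h
    · calc cubeM L (k + 1) K' ≤ max (cubeM L (k + 1) Ks) (R₁M₁ + 3 / 2) := hK'le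
        _ = R₁M₁ + 3 / 2 := max_eq_right h
        _ ≤ (R₁M₁ + 3 / 2) * cubeM L (k + 1) Ks := by nlinarith
    · calc cubeM L (k + 1) K' ≤ max (cubeM L (k + 1) Ks) (R₁M₁ + 3 / 2) := hK'le
        _ = cubeM L (k + 1) Ks := max_eq_left h
        _ ≤ (R₁M₁ + 3 / 2) * cubeM L (k + 1) Ks := by nlinarith
  have hB : C.B₃ * (cubeM L (k + 1) K' / cubeM L (k + 1) Ks) ≤ (R₁M₁ + 3 / 2) * C.B₃ := by
    have := C.B₃_pos
    nlinarith
  exact regularity_torusVP_mono_bound hL hB hε₁ hres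

/-- **(T8) FROM THEOREM 1 ON PRINT's WINDOW** — the existence clause reads no cube: verbatim as for `torusVP` ∕ `torusVPCls`. [cite: Balaban1985Variational, Thm 1 (8) p.279] [folklore] -/
theorem exists8Min_of_thm1At_torusVPWin {Mlo Mhi : ℝ} (C : B11Thm1.Consts) (hT : ∀ k : ℕ, Thm1At C (torusVPWin d L N G (k + 1) Mlo Mhi)) :
    ∀ (k : ℕ) (ε₁ : ℝ), 0 < ε₁ → ε₁ ≤ C.a₁ → ∀ V : Site d → Fin d → (Matrix n n ℂ)ˣ, V ∈ sfClass d L N ε₁ 0 →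
      ∃ U : Site d → Fin d → (Matrix n n ℂ)ˣ, IsMinimiser d (sfClass d L N (C.B₃ * ε₁)) L N (k + 1) V U := by
  intro k ε₁ hε₁ hε₁a V hV
  obtain ⟨⟨U, -, -, hmin⟩, -, -⟩ := hT k ε₁ hε₁ hε₁a V hV
  exact ⟨U, hmin⟩

end

end Summit.QuantumFields.YangMills.BalabanUVNodes.N16SlotKeyClassContainment
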